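import Summits.ResolutionOfSingularities.ResolutionOfSingularities.Theorems.EquisingularLiftEquisingularLiftNatSpecimenSteinerStrictChart0Packet
import Summits.ResolutionOfSingularities.ResolutionOfSingularities.Theorems.EquisingularLiftEquisingularLiftNatSpecimenQuarticTcDeltaTransport
import Literature.AlgebraicGeometry.Motives.CellularPeeling
import HarnessLib

/-!
# [OURS · L1 W4.5(b) · EL♮(3) · NOSE, N-2 (d) far packets] STEINER — THE THREE FAR-CHART PACKETS OF THE STRICT TRANSFORM, BY THE 𝔖₃-SYMMETRY OF `F`

res-L1-w45b-nose-w2 g2 (WIDTH seat on D-0157 DOOR 1; self-dealt under the desk's N-2 GO, STATUS l.≈83270). OURS; NOT a statement of any manuscript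
([Hironaka2017] is a candidate under adjudication, nothing of it is asserted); AI-written, weaker than expert review. No `sorry`; standard axioms; DEF-FREE
(standing `local instance` attribute of the specimen files). `--kind proof --supports stmt-ResolutionOfSingularities-20148 --as helper`; closes nothing.
Resolution of singularities in positive characteristic is NOT proved here or anywhere in this chain (dimension 3 is Cossart–Piltant 2008/2009 in print);
EL♮(3) is NOT proved by this file.

WHAT. Off the exceptional divisor the blowing up `υ : F₂ ⟶ ℙ³` of the triple point `P` is an isomorphism, so over the standard chart `D₊(x_c)` (`c = 0, 1, 2`;
`P ∉ D₊(x_c)`) the reduced strict transform `St~` of the Roman surface IS the affine piece `S ∩ D₊(x_c) = V(F(x_c := 1))`, and the nose set `Z′ = ⋃ᵢ Lᵢ′`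
is the double line `L_c ∩ D₊(x_c)` (the other two lines lie in `V(x_c)`). §1 `F(x_c := 1)` is ONE polynomial for all three `c` (symmetry of `F` in
`x₀, x₁, x₂`), namely `ρ⁻¹ g` for the cyclic renaming `ρ = finRotate 3` and ✓ `Steiner.g` (p649392's far-chart equation, double line `(T₁, T₂)`); §2 the
chart `D₊(x_c)` pulls `𝓘⟨S⟩` back to `(ρ⁻¹ g)~` and `𝓘⟨L_c⟩` to `(T₀, T₁)~`, and misses `P` and the other lines; §3 over `υ⁻¹D₊(x_c)`: `St ∩ υ⁻¹D₊(x_c) =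
υ⁻¹(S ∩ D₊(x_c))`, `Z′ ∩ υ⁻¹D₊(x_c) = υ⁻¹(L_c ∩ D₊(x_c))` (✓ `strictTransform_inter_preimage_eq`), read on the lifted chart ✓ `SpecimenQuarticTcDelta.liftChart`;
§4 ★★ `packet_far c` — for EVERY `c : Fin 3`: an open immersion `Spec (k[T]/(g)) ⟶ St~` covering `St~` over `υ⁻¹D₊(x_c)`, on which `𝓘⟨Z′⟩·𝒪_{St~} =
((T̄₁, T̄₂))~` with blow-up algebras REGULAR (✓ `Steiner.isRegularRing_chartFar₁/₂` verbatim — the charts through the pinch points) — the per-chart datum of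
✓ `isRegular_of_isBlowup_of_chartAtlas`. With ✓ `Steiner.packet_chart` (vertex charts) and ✓ `mem_preimage_basicOpen_or_mem_opensRange` (cover) this is the
whole atlas of clause (d); the assembly (`hfin`) is the next file.
-/

set_option linter.dupNamespace false -- mandated namespace `Summit.<Summit>.<Problem>` of this single-conjunct summit

noncomputable section

open CategoryTheory CategoryTheory.Limits AlgebraicGeometry TopologicalSpace HomogeneousLocalization
open MvPolynomial
open Literature.AlgebraicGeometry.Resolution Literature.AlgebraicGeometry.Resolution.DeJong1996
open Literature.AlgebraicGeometry.Motives Literature.AlgebraicGeometry.Motives.SmoothHypersurface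
open Literature.AlgebraicGeometry.Motives.ProjectiveSpace
open AlgebraicGeometry.Scheme.IdealSheafData
open Summit.ResolutionOfSingularities.ResolutionOfSingularities.Theorems.EquisingularLift

attribute [local instance] MvPolynomial.gradedAlgebra ProjBaseChange.algebraBase

namespace Summit.ResolutionOfSingularities.ResolutionOfSingularities.Cruxes.EquisingularLiftNat.Sections

namespace Steiner

variable (k : Type) [Field k]

/-! ## §1 The far-chart equation: `F(x_c := 1) = ρ⁻¹ g` for all `c`, and the cyclic renaming `ρ` -/

/-- **`F(x_c := 1)` is the same polynomial `T₀² + T₀²T₁² + T₁² + T₀T₁T₂` for `c = 0, 1, 2`**, which is `ρ⁻¹ g` (`ρ = (0 1 2)`, ✓ `Steiner.g`). [folklore] -/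
theorem dehomogenize_form_castSucc (c : Fin 3) :
    dehomogenize k (Fin.castSucc c) (form k) = (renameEquiv k (finRotate 3)).symm (g k) := by
  have r0 : (finRotate 3).symm (0 : Fin 3) = 2 := by decide
  have r1 : (finRotate 3).symm (1 : Fin 3) = 0 := by decide
  have r2 : (finRotate 3).symm (2 : Fin 3) = 1 := by decide
  rw [renameEquiv_symm, renameEquiv_apply]
  fin_cases c
  · change dehomogenize k 0 (form k) = _
    simp only [form, g, map_add, map_mul, map_pow, dehomogenize_X_self, WhitneyCubic.dehomogenize_X_of_eq k 0 1 0 (by decide),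
      WhitneyCubic.dehomogenize_X_of_eq k 0 2 1 (by decide), WhitneyCubic.dehomogenize_X_of_eq k 0 3 2 (by decide), rename_X, r0, r1, r2]
    ring
  · change dehomogenize k 1 (form k) = _
    simp only [form, g, map_add, map_mul, map_pow, dehomogenize_X_self, WhitneyCubic.dehomogenize_X_of_eq k 1 0 0 (by decide),
      WhitneyCubic.dehomogenize_X_of_eq k 1 2 1 (by decide), WhitneyCubic.dehomogenize_X_of_eq k 1 3 2 (by decide), rename_X, r0, r1, r2]
    ring
  · change dehomogenize k 2 (form k) = _
    simp only [form, g, map_add, map_mul, map_pow, dehomogenize_X_self, WhitneyCubic.dehomogenize_X_of_eq k 2 0 0 (by decide),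
      WhitneyCubic.dehomogenize_X_of_eq k 2 1 1 (by decide), WhitneyCubic.dehomogenize_X_of_eq k 2 3 2 (by decide), rename_X, r0, r1, r2]
    ring

/-- `ρ⁻¹ g` is prime (transport of ✓ `Steiner.prime_g`). [folklore] -/
theorem prime_renameEquiv_symm_g : Prime ((renameEquiv k (finRotate 3)).symm (g k)) :=
  (MulEquiv.prime_iff (renameEquiv k (finRotate 3)).symm.toMulEquiv).mpr (prime_g k)

/-- `ρ` carries `(ρ⁻¹ g)` to `(g)`. [folklore] -/
theorem map_renameEquiv_span_symm_g :
    (Ideal.span {(renameEquiv k (finRotate 3)).symm (g k)}).map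
        ((renameEquiv k (finRotate 3)).toRingEquiv : MvPolynomial (Fin 3) k →+* MvPolynomial (Fin 3) k) = Ideal.span {g k} := by
  rw [Ideal.map_span, Set.image_singleton]
  exact congrArg (fun x => Ideal.span {x}) ((renameEquiv k (finRotate 3)).apply_symm_apply (g k))

/-- `ρ` carries `(T₀, T₁)` to the centre variables `(T₁, T₂) = (X_j : j ∈ cenVars)` of ✓ p649392. [folklore] -/
theorem map_renameEquiv_span_X_pair :
    (Ideal.span (X '' ({0, 1} : Set (Fin 3)) : Set (MvPolynomial (Fin 3) k))).map
        ((renameEquiv k (finRotate 3)).toRingEquiv : MvPolynomial (Fin 3) k →+* MvPolynomial (Fin 3) k) =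
      Ideal.span (X '' CuspCone.cenVars) := by
  have hρ : (finRotate 3) '' ({0, 1} : Set (Fin 3)) = CuspCone.cenVars := by
    have r0 : (finRotate 3) (0 : Fin 3) = 1 := by decide
    have r1 : (finRotate 3) (1 : Fin 3) = 2 := by decide
    rw [Set.image_pair, r0, r1]
  rw [Ideal.map_span, Set.image_image, ← hρ, Set.image_image]
  refine congrArg Ideal.span (Set.image_congr fun j _ => ?_)
  change rename (finRotate 3) (X j) = X (finRotate 3 j)
  rw [rename_X]

/-- The generator family `T̄ⱼ` (`j ≠ 0`) of the centre on a chart ring `k[T]/𝔭` spans `((T₁, T₂))·(k[T]/𝔭)`. [folklore] -/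
theorem span_range_mk_X_compl_zero (p : Ideal (MvPolynomial (Fin 3) k)) :
    Ideal.span (Set.range fun j : ↥({(0 : Fin 3)}ᶜ : Set (Fin 3)) => Ideal.Quotient.mk p (X j.1 : MvPolynomial (Fin 3) k)) =
      (Ideal.span (X '' CuspCone.cenVars)).map (Ideal.Quotient.mk p) := by
  have hcen : (CuspCone.cenVars : Set (Fin 3)) = {(0 : Fin 3)}ᶜ := by
    ext j; fin_cases j <;> simp [CuspCone.cenVars]
  rw [Ideal.map_span, Set.image_image, hcen]
  congr 1
  ext x
  simp only [Set.mem_range, Set.mem_image, Subtype.exists, Set.mem_compl_iff, Set.mem_singleton_iff, exists_prop]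

/-! ## §2 The standard chart `D₊(x_c)` of `ℙ³`: it misses `P` and the other two lines, and carries `S` to `V(ρ⁻¹ g)`, `L_c` to `V(T₀, T₁)` -/

/-- `P ∉ D₊(x_c)`: `{P} ∩ D₊(x_c) = ∅`. [folklore] -/
theorem vertex_inter_range_chartι (c : Fin 3) :
    ({vertex 2 k} : Set (SpecimenQuarticTcDelta.P3 k)) ∩ Set.range (ProjectiveSpaceCells.chartι k 3 (Fin.castSucc c)) = ∅ := by
  rw [Set.singleton_inter_eq_empty]
  change vertex 2 k ∉ Set.range (ProjectiveSpaceCells.chartι k 3 (Fin.castSucc c)).base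
  rw [ProjectiveSpaceCells.range_chartι]
  exact vertex_notMem_basicOpen 2 k c

/-- The other lines miss the chart: `L_i ∩ D₊(x_c) = ∅` for `i ≠ c` (`x_c` vanishes on `L_i`). [folklore] -/
theorem vertexLine_inter_range_chartι_of_ne {i c : Fin 3} (h : i ≠ c) :
    vertexLine 2 k i ∩ Set.range (ProjectiveSpaceCells.chartι k 3 (Fin.castSucc c)) = ∅ := by
  rw [← Set.disjoint_iff_inter_eq_empty, Set.disjoint_left]
  intro x hx hx'
  change x ∈ Set.range (ProjectiveSpaceCells.chartι k 3 (Fin.castSucc c)).base at hx'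
  rw [ProjectiveSpaceCells.range_chartι] at hx'
  exact (Proj.mem_basicOpen _ _ _).mp hx' ((mem_vertexLine_iff i x).mp hx c (Ne.symm h))

/-- **`D₊(x_c) ∩ S = V(ρ⁻¹ g)` in the chart.** [cite: Hartshorne1977, II Prop. 2.5] (OURS computation) -/
theorem preimage_chartι_castSucc_range_ι (c : Fin 3) :
    (ProjectiveSpaceCells.chartι k 3 (Fin.castSucc c)) ⁻¹' Set.range (hypersurfaceι (form k)).left =
      PrimeSpectrum.zeroLocus {(renameEquiv k (finRotate 3)).symm (g k)} := by
  erw [range_hypersurfaceι]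
  rw [← dehomogenize_form_castSucc]
  exact ProjectiveSpaceCells.chartι_preimage_zeroLocus_of_mem k (Fin.castSucc c) (by norm_num : 0 < 4)
    ((mem_homogeneousSubmodule 4 _).mpr (isHomogeneous_form k))

/-- **`𝓘⟨S⟩ · 𝒪_{D₊(x_c)} = (ρ⁻¹ g)~`** (the preimage is `V(ρ⁻¹ g)`, a prime). [folklore] -/
theorem comap_chartι_castSucc_vanishingIdeal_range (c : Fin 3) :
    (vanishingIdeal (⟨Set.range (hypersurfaceι (form k)).left, isClosed_range_ι k⟩ : Closeds (SpecimenQuarticTcDelta.P3 k))).comap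
        (ProjectiveSpaceCells.chartι k 3 (Fin.castSucc c)) =
      affineBlowup.idealSheaf (Ideal.span {(renameEquiv k (finRotate 3)).symm (g k)}) := by
  rw [comap_vanishingIdeal_of_isOpenImmersion]
  have h : (Closeds.preimage (⟨Set.range (hypersurfaceι (form k)).left, isClosed_range_ι k⟩ : Closeds (SpecimenQuarticTcDelta.P3 k))
      (ProjectiveSpaceCells.chartι k 3 (Fin.castSucc c)).continuous) =
      ⟨PrimeSpectrum.zeroLocus {(renameEquiv k (finRotate 3)).symm (g k)}, PrimeSpectrum.isClosed_zeroLocus _⟩ :=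
    Closeds.ext (preimage_chartι_castSucc_range_ι k c)
  rw [h, SpecimenQuarticTcDelta.vanishingIdeal_zeroLocus_Spec,
    ((Ideal.span_singleton_prime (prime_renameEquiv_symm_g k).ne_zero).mpr (prime_renameEquiv_symm_g k)).radical]
  rfl

/-- **`D₊(x_c) ∩ L_c = V(T₀, T₁)` in the chart** (the surviving variables other than `x₃/x_c`). [folklore] -/
theorem preimage_chartι_castSucc_vertexLine (c : Fin 3) :
    (ProjectiveSpaceCells.chartι k 3 (Fin.castSucc c)) ⁻¹' vertexLine 2 k c =
      PrimeSpectrum.zeroLocus (X '' ({0, 1} : Set (Fin 3)) : Set (MvPolynomial (Fin 3) k)) := by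
  -- the chart reads the variable `x_{c.succAbove m}` as `T_m`
  have key : ∀ (m : Fin 3) (𝔭 : Spec (CommRingCat.of (MvPolynomial (Fin 3) k))),
      (X ((Fin.castSucc c).succAbove m) : MvPolynomial (Fin (3 + 1)) k) ∈
          (ProjectiveSpaceCells.chartι k 3 (Fin.castSucc c) 𝔭).asHomogeneousIdeal ↔ (X m : MvPolynomial (Fin 3) k) ∈ 𝔭.asIdeal := fun m 𝔭 => by
    have h := Set.ext_iff.mp (ProjectiveSpaceCells.chartι_preimage_zeroLocus_X k 3 (Fin.castSucc c) m) 𝔭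
    exact Set.singleton_subset_iff.symm.trans (h.trans Set.singleton_subset_iff)
  -- the surviving centre variables: `{x_j : j ≠ c, j ≤ 2} = {x_{c.succAbove m} : m = 0, 1}`
  have idx : ∀ j : Fin 3, j ≠ c → ∃ m : Fin 3, m ∈ ({0, 1} : Set (Fin 3)) ∧ Fin.castSucc j = (Fin.castSucc c).succAbove m := by
    intro j hjc
    fin_cases c <;> fin_cases j <;>
      first
        | exact absurd rfl hjc
        | exact ⟨0, by simp, by decide⟩
        | exact ⟨1, by simp, by decide⟩
  have idx' : ∀ m : Fin 3, m ∈ ({0, 1} : Set (Fin 3)) → ∃ j : Fin 3, j ≠ c ∧ Fin.castSucc j = (Fin.castSucc c).succAbove m := by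
    intro m hm
    simp only [Set.mem_insert_iff, Set.mem_singleton_iff] at hm
    rcases hm with rfl | rfl <;> fin_cases c <;>
      first
        | exact ⟨0, by decide, by decide⟩
        | exact ⟨1, by decide, by decide⟩
        | exact ⟨2, by decide, by decide⟩
  ext 𝔭
  constructor
  · intro h𝔭
    have hj := (mem_vertexLine_iff c _).mp h𝔭
    rintro _ ⟨m, hm, rfl⟩
    apply (key m 𝔭).mp
    obtain ⟨j, hjc, hjm⟩ := idx' m hm
    rw [← hjm]
    exact hj j hjc
  · intro h𝔭
    apply (mem_vertexLine_iff c _).mpr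
    intro j hjc
    obtain ⟨m, hm, hjm⟩ := idx j hjc
    have h := (key m 𝔭).mpr (h𝔭 ⟨m, hm, rfl⟩)
    rw [← hjm] at h
    exact h

/-- **`𝓘⟨L_c⟩ · 𝒪_{D₊(x_c)} = (T₀, T₁)~`** (prime, ✓ `isPrime_span_X_image`). [folklore] -/
theorem comap_chartι_castSucc_vanishingIdeal_vertexLine (c : Fin 3) :
    (vanishingIdeal (⟨vertexLine 2 k c, isClosed_vertexLine c⟩ : Closeds (SpecimenQuarticTcDelta.P3 k))).comap
        (ProjectiveSpaceCells.chartι k 3 (Fin.castSucc c)) =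
      affineBlowup.idealSheaf (Ideal.span (X '' ({0, 1} : Set (Fin 3)) : Set (MvPolynomial (Fin 3) k))) := by
  rw [comap_vanishingIdeal_of_isOpenImmersion]
  have h : (Closeds.preimage (⟨vertexLine 2 k c, isClosed_vertexLine c⟩ : Closeds (SpecimenQuarticTcDelta.P3 k))
      (ProjectiveSpaceCells.chartι k 3 (Fin.castSucc c)).continuous) =
      ⟨PrimeSpectrum.zeroLocus (X '' ({0, 1} : Set (Fin 3)) : Set (MvPolynomial (Fin 3) k)), PrimeSpectrum.isClosed_zeroLocus _⟩ :=
    Closeds.ext (preimage_chartι_castSucc_vertexLine k c)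
  rw [h]
  refine (SpecimenQuarticTcDelta.vanishingIdeal_zeroLocus_Spec (CommRingCat.of (MvPolynomial (Fin 3) k)) _).trans ?_
  rw [(Literature.RingTheory.MvPolynomial.isPrime_span_X_image (R := k) ({0, 1} : Set (Fin 3))).radical]
  rfl

/-! ## §3 Over `υ⁻¹D₊(x_c)`: the strict transform is `υ⁻¹S`, the nose set is `υ⁻¹L_c` -/

section Far

variable {k} {F₂ : Scheme.{0}} {υ : F₂ ⟶ SpecimenQuarticTcDelta.P3 k} (hυ : IsBlowup υ (vertexIdealSheaf 2 k))

include hυ in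
/-- **`υ` is an isomorphism over `D₊(x_c)`** (`P ∉ D₊(x_c)`; Stacks 02OS via ✓ `IsBlowup.isIso_morphismRestrict`). [cite: StacksProject, Tag 02OS] -/
theorem isIso_morphismRestrict_opensRange_chartι (c : Fin 3) :
    IsIso (υ ∣_ (ProjectiveSpaceCells.chartι k 3 (Fin.castSucc c)).opensRange) :=
  hυ.isIso_morphismRestrict (by
    rw [vertexIdealSheaf, Scheme.IdealSheafData.coe_support_vanishingIdeal]
    change Disjoint (Set.range (ProjectiveSpaceCells.chartι k 3 (Fin.castSucc c))) {vertex 2 k}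
    rw [Set.disjoint_singleton_right]
    intro h
    have h' := vertex_inter_range_chartι k c
    rw [Set.singleton_inter_eq_empty] at h'
    exact h' h)

/-- **The strict transform over `D₊(x_c)` is the total transform**: `St ∩ υ⁻¹D₊(x_c) = υ⁻¹(S ∩ D₊(x_c))`. [folklore] -/
theorem strict_inter_preimage_range_chartι (c : Fin 3) :
    closure (υ ⁻¹' (Set.range (hypersurfaceι (form k)).left \ {vertex 2 k})) ∩
        υ ⁻¹' Set.range (ProjectiveSpaceCells.chartι k 3 (Fin.castSucc c)) =
      υ ⁻¹' (Set.range (hypersurfaceι (form k)).left ∩ Set.range (ProjectiveSpaceCells.chartι k 3 (Fin.castSucc c))) := by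
  rw [Set.preimage_inter]
  exact SpecimenQuarticTcDelta.strictTransform_inter_preimage_eq υ (ProjectiveSpaceCells.chartι k 3 (Fin.castSucc c)).isOpenEmbedding.isOpen_range
    (isClosed_range_ι k) rfl (vertex_inter_range_chartι k c)

/-- **The nose set over `D₊(x_c)` is the total transform of `L_c`**: `Z′ ∩ υ⁻¹D₊(x_c) = υ⁻¹(L_c ∩ D₊(x_c))`. [folklore] -/
theorem noseSet_inter_preimage_range_chartι (c : Fin 3) :
    (⋃ i : Fin 3, vertexLineStrict υ i) ∩ υ ⁻¹' Set.range (ProjectiveSpaceCells.chartι k 3 (Fin.castSucc c)) =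
      υ ⁻¹' (vertexLine 2 k c ∩ Set.range (ProjectiveSpaceCells.chartι k 3 (Fin.castSucc c))) := by
  have hO := (ProjectiveSpaceCells.chartι k 3 (Fin.castSucc c)).isOpenEmbedding.isOpen_range
  have hi : ∀ i : Fin 3, vertexLineStrict υ i ∩ υ ⁻¹' Set.range (ProjectiveSpaceCells.chartι k 3 (Fin.castSucc c)) =
      υ ⁻¹' (vertexLine 2 k i ∩ Set.range (ProjectiveSpaceCells.chartι k 3 (Fin.castSucc c))) := fun i => by
    rw [Set.preimage_inter]
    exact SpecimenQuarticTcDelta.strictTransform_inter_preimage_eq υ hO (isClosed_vertexLine i) rfl (vertex_inter_range_chartι k c)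
  rw [Set.iUnion_inter]
  apply Set.Subset.antisymm
  · refine Set.iUnion_subset fun i => ?_
    rw [hi i]
    by_cases h : i = c
    · rw [h]
    · rw [vertexLine_inter_range_chartι_of_ne k h, Set.preimage_empty]
      exact Set.empty_subset _
  · rw [← hi c]
    exact Set.subset_iUnion (fun i => vertexLineStrict υ i ∩ υ ⁻¹' Set.range (ProjectiveSpaceCells.chartι k 3 (Fin.castSucc c))) c

/-! ## §4 The far packets -/

include hυ in
/-- ★★ **FAR PACKETS `c = 0, 1, 2` of clause (d)**, uniformly in `c : Fin 3`, in the currency of ✓ p649392: an OPEN IMMERSION `Spec (k[T]/(g)) ⟶ St~`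
(the lifted chart of `D₊(x_c)` twisted by `ρ`, restricted to the reduced strict transform — ✓ `exists_openImmersion_specQuotient`) covering every point of `St~`
over `υ⁻¹D₊(x_c)`, on which `𝓘⟨Z′⟩·𝒪_{St~} = ((T̄₁, T̄₂))~`, with generators whose blow-up algebras are REGULAR RINGS (✓ `Steiner.isRegularRing_chartFar₁/₂`)
— the per-chart datum `(A, c, g, hJ, hreg)` of ✓ `isRegular_of_isBlowup_of_chartAtlas`. [OURS · L1 W4.5b · (d) far packets] -/
theorem packet_far (c : Fin 3) :
    ∃ (c' : Spec (CommRingCat.of (MvPolynomial (Fin 3) k ⧸ Ideal.span {g k})) ⟶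
        redSub F₂ (closure (υ ⁻¹' (Set.range (hypersurfaceι (form k)).left \ {vertex 2 k}))) isClosed_closure) (_ : IsOpenImmersion c'),
      (∀ z, υ (redSubι F₂ _ isClosed_closure z) ∈
          Proj.basicOpen (Segre.grading (Fin (2 + 1 + 1)) k) (MvPolynomial.X (Fin.castSucc c) : MvPolynomial (Fin (2 + 1 + 1)) k) →
        z ∈ Set.range c') ∧
      ((vanishingIdeal (⟨⋃ j : Fin 3, vertexLineStrict υ j, isClosed_iUnion_vertexLineStrict υ⟩ : Closeds F₂)).comap
          (redSubι F₂ _ isClosed_closure)).comap c' =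
        affineBlowup.idealSheaf (Ideal.span (Set.range fun j : ↥({(0 : Fin 3)}ᶜ : Set (Fin 3)) =>
          Ideal.Quotient.mk (Ideal.span {g k}) (X j.1 : MvPolynomial (Fin 3) k))) ∧
      (∀ j : ↥({(0 : Fin 3)}ᶜ : Set (Fin 3)), IsRegularRing (blowupAlgebra
        (Ideal.span (Set.range fun j : ↥({(0 : Fin 3)}ᶜ : Set (Fin 3)) => Ideal.Quotient.mk (Ideal.span {g k}) (X j.1 : MvPolynomial (Fin 3) k)))
        (Ideal.Quotient.mk (Ideal.span {g k}) (X j.1 : MvPolynomial (Fin 3) k)))) := by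
  haveI : IsReduced (redSub F₂ (closure (υ ⁻¹' (Set.range (hypersurfaceι (form k)).left \ {vertex 2 k}))) isClosed_closure) :=
    ComponentGluing.isReduced_subscheme_vanishingIdeal _
  haveI := isIso_morphismRestrict_opensRange_chartι hυ c
  -- the lifted chart `ℓ : Spec k[T] ⟶ F₂` of `D₊(x_c)` and the twist `Spec ρ`
  set u := ProjectiveSpaceCells.chartι k 3 (Fin.castSucc c) with hu
  set ℓ := SpecimenQuarticTcDelta.liftChart υ u with hℓ
  haveI hiso : IsIso (Spec.map (CommRingCat.ofHom ((renameEquiv k (finRotate 3)).toRingEquiv : MvPolynomial (Fin 3) k →+* MvPolynomial (Fin 3) k))) := by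
    change IsIso (Spec.map (renameEquiv k (finRotate 3)).toRingEquiv.toCommRingCatIso.hom); infer_instance
  haveI : IsOpenImmersion (Spec.map (CommRingCat.ofHom ((renameEquiv k (finRotate 3)).toRingEquiv :
      MvPolynomial (Fin 3) k →+* MvPolynomial (Fin 3) k)) ≫ ℓ) := inferInstance
  -- the pull-backs along `ℓ`, then along the twist
  have hSt : (vanishingIdeal (⟨closure (υ ⁻¹' (Set.range (hypersurfaceι (form k)).left \ {vertex 2 k})), isClosed_closure⟩ : Closeds F₂)).comap ℓ =
      affineBlowup.idealSheaf (Ideal.span {(renameEquiv k (finRotate 3)).symm (g k)}) := by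
    rw [hℓ, SpecimenQuarticTcDelta.comap_liftChart_of_inter_eq υ u isClosed_closure (isClosed_range_ι k) (strict_inter_preimage_range_chartι c)]
    exact comap_chartι_castSucc_vanishingIdeal_range k c
  have hZ : (vanishingIdeal (⟨⋃ j : Fin 3, vertexLineStrict υ j, isClosed_iUnion_vertexLineStrict υ⟩ : Closeds F₂)).comap ℓ =
      affineBlowup.idealSheaf (Ideal.span (X '' ({0, 1} : Set (Fin 3)) : Set (MvPolynomial (Fin 3) k))) := by
    rw [hℓ, SpecimenQuarticTcDelta.comap_liftChart_of_inter_eq υ u (isClosed_iUnion_vertexLineStrict υ) (isClosed_vertexLine c)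
      (noseSet_inter_preimage_range_chartι c)]
    exact comap_chartι_castSucc_vanishingIdeal_vertexLine k c
  have hIc : (redSubι F₂ (closure (υ ⁻¹' (Set.range (hypersurfaceι (form k)).left \ {vertex 2 k}))) isClosed_closure).ker.comap
      (Spec.map (CommRingCat.ofHom ((renameEquiv k (finRotate 3)).toRingEquiv : MvPolynomial (Fin 3) k →+* MvPolynomial (Fin 3) k)) ≫ ℓ) =
      affineBlowup.idealSheaf (Ideal.span {g k}) := by
    rw [ker_subschemeι, Scheme.IdealSheafData.comap_comp, hSt, affineBlowup.comap_idealSheaf_specMap, map_renameEquiv_span_symm_g]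
  have hZ' : (vanishingIdeal (⟨⋃ j : Fin 3, vertexLineStrict υ j, isClosed_iUnion_vertexLineStrict υ⟩ : Closeds F₂)).comap
      (Spec.map (CommRingCat.ofHom ((renameEquiv k (finRotate 3)).toRingEquiv : MvPolynomial (Fin 3) k →+* MvPolynomial (Fin 3) k)) ≫ ℓ) =
      affineBlowup.idealSheaf (Ideal.span (X '' CuspCone.cenVars)) := by
    rw [Scheme.IdealSheafData.comap_comp, hZ, affineBlowup.comap_idealSheaf_specMap, map_renameEquiv_span_X_pair]
  obtain ⟨c', hc', hcomm, hcov⟩ := exists_openImmersion_specQuotient (redSubι F₂ _ isClosed_closure) _ (Ideal.span {g k}) hIc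
  refine ⟨c', hc', fun z hz => hcov z ?_, ?_, fun j => ?_⟩
  · -- `υ z ∈ D₊(x_c)` puts `z` over the lifted chart, hence over its twist
    have hz' : (redSubι F₂ _ isClosed_closure z : F₂) ∈ Set.range ℓ := by
      rw [hℓ, SpecimenQuarticTcDelta.range_liftChart, Set.mem_preimage]
      change _ ∈ Set.range (ProjectiveSpaceCells.chartι k 3 (Fin.castSucc c)).base
      rw [ProjectiveSpaceCells.range_chartι]
      exact hz
    obtain ⟨y, hy⟩ := hz'
    obtain ⟨y', hy'⟩ := (Scheme.homeoOfIso (asIso (Spec.map (CommRingCat.ofHom ((renameEquiv k (finRotate 3)).toRingEquiv :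
      MvPolynomial (Fin 3) k →+* MvPolynomial (Fin 3) k))))).surjective y
    refine ⟨y', ?_⟩
    rw [Scheme.Hom.comp_apply]
    have : (Spec.map (CommRingCat.ofHom ((renameEquiv k (finRotate 3)).toRingEquiv : MvPolynomial (Fin 3) k →+* MvPolynomial (Fin 3) k))) y' = y := hy'
    rw [this, hy]
  · rw [comap_comap_of_chart _ _ _ c' hcomm _ _ hZ', span_range_mk_X_compl_zero]
  · obtain ⟨j, hj⟩ := j
    have hj' : j = 1 ∨ j = 2 := by
      have : j ≠ 0 := hj
      fin_cases j <;> simp_all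
    rw [span_range_mk_X_compl_zero]
    rcases hj' with rfl | rfl
    · exact isRegularRing_chartFar₁ k
    · exact isRegularRing_chartFar₂ k

end Far

end Steiner

end Summit.ResolutionOfSingularities.ResolutionOfSingularities.Cruxes.EquisingularLiftNat.Sections

end
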